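import Summits.NavierStokesRegularity.NavierStokesRegularity.Theorems.FilamentSkeletonRssKelvinGateDefs
import Summits.NavierStokesRegularity.NavierStokesRegularity.Theorems.FilamentSkeletonRssKelvinGateCalculus

/-!
# Route `FilamentSkeletonRss` · crux `TransverseReductionRJ` (stmt-NavierStokesRegularity-21221) — line `kelvin_gate`,
# stub S2 `PolynomialKelvinGate`: the X/Y scales are vector spaces, the gate spec is monotone in its constants,
# and the stub's NORMAL FORM (`Cs > 0`, `Cr ≥ 0`, `Γ ≥ 1` without loss)

Helper file (theorems only, `--supports stmt-NavierStokesRegularity-21221 --as helper`), in the vocabulary of the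
registered line made importable by `FilamentSkeletonRssKelvinGateDefs` (`Theorems.KelvinGate.*`).  HONEST FRAMING:
bookkeeping for a HYPOTHETICAL filament-type RSS blow-up route; nothing here bears on Navier–Stokes regularity, and
nothing here proves the stub (an open-problem-sized uniform linear estimate).  What is here:

* `XBound.*`, `YBound.*` — the weighted `C²` / `C¹` sup-scales of the line are closed under `0`, `+`, scalar
  multiples, are monotone in the radius, force `0 ≤ R`, and radius `≤ 0` forces the zero field
  (so a gate is automatically `0 ↦ 0`, and S3's contraction ball is a ball in a genuine normed cone);
* `lerayLin_add_smul`, `lerayOp_add_eq` — the line's `lerayLin` IS linear and IS the linearisation of `lerayOp`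
  (def-form corollaries of `FilamentSkeletonRssKelvinGateCalculus`);
* `GateSpec.mono` — a gate with constants `(κ, C₂)` is a gate with any larger constants once `Γ ≥ 1`
  (so S2 provers may prove the spec with whatever polynomial loss comes out and enlarge afterwards);
* `BaseSpec.pos`, `polynomialKelvinGate_iff_pos` — in `PolynomialKelvinGate` one may assume `0 < Cs`, `0 ≤ Cr` and
  `1 ≤ Γ₁`: for `Cs ≤ 0` or `Cr < 0` the base-family spec `BaseSpec` is uninhabited at every `Γ > 0` (the size bound
  `XBound (U⁰_p) (Cs Γ⁴)` kills the non-degeneracy `‖U⁰_p y₀‖ ≥ 1`, resp. `YBound r (Cr Γ^{-k})` is impossible), so the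
  stub holds there vacuously.  This is the honest core of S2: positive size constant, non-negative residual constant,
  large circulation.
-/

set_option linter.dupNamespace false

noncomputable section

namespace Summit.NavierStokesRegularity.NavierStokesRegularity.Theorems.KelvinGate

open Set Function
open Literature.Analysis.FluidPDE
open scoped InnerProductSpace Laplacian ContDiff Topology

/-! ## The X-scale -/

/-- An X-bound forces `0 ≤ R` (evaluate at any point). -/
theorem XBound.nonneg {W : EuclideanSpace ℝ (Fin 3) → EuclideanSpace ℝ (Fin 3)} {R : ℝ} (h : XBound W R) : 0 ≤ R :=
  le_trans (mul_nonneg (by positivity) (norm_nonneg _)) (h.2 0).1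

/-- X-bounds are monotone in the radius. -/
theorem XBound.mono {W : EuclideanSpace ℝ (Fin 3) → EuclideanSpace ℝ (Fin 3)} {R R' : ℝ} (h : XBound W R)
    (hR : R ≤ R') : XBound W R' :=
  ⟨h.1, fun y => ⟨(h.2 y).1.trans hR, (h.2 y).2.1.trans hR, (h.2 y).2.2.trans hR⟩⟩

/-- The pointwise decay encoded by an X-bound: `‖W y‖ ≤ R / (1 + ‖y‖)`. -/
theorem XBound.norm_le {W : EuclideanSpace ℝ (Fin 3) → EuclideanSpace ℝ (Fin 3)} {R : ℝ} (h : XBound W R)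
    (y : EuclideanSpace ℝ (Fin 3)) : ‖W y‖ ≤ R / (1 + ‖y‖) := by
  rw [le_div_iff₀ (by positivity), mul_comm]
  exact (h.2 y).1

/-- The pointwise decay of the derivative encoded by an X-bound: `‖DW y‖ ≤ R / (1 + ‖y‖)`. -/
theorem XBound.norm_fderiv_le {W : EuclideanSpace ℝ (Fin 3) → EuclideanSpace ℝ (Fin 3)} {R : ℝ} (h : XBound W R)
    (y : EuclideanSpace ℝ (Fin 3)) : ‖fderiv ℝ W y‖ ≤ R / (1 + ‖y‖) := by
  rw [le_div_iff₀ (by positivity), mul_comm]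
  exact (h.2 y).2.1

/-- An X-bound of radius `≤ 0` forces the zero field. -/
theorem XBound.eq_zero_of_nonpos {W : EuclideanSpace ℝ (Fin 3) → EuclideanSpace ℝ (Fin 3)} {R : ℝ}
    (h : XBound W R) (hR : R ≤ 0) : W = fun _ => 0 := by
  funext y
  have h1 : (1 + ‖y‖) * ‖W y‖ ≤ 0 := (h.2 y).1.trans hR
  have h2 : ‖W y‖ ≤ 0 := by
    by_contra hlt
    push Not at hlt
    exact absurd h1 (not_le.mpr (mul_pos (by positivity) hlt))
  exact norm_le_zero_iff.mp h2

/-- The zero field is X-bounded with radius `0`. -/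
theorem xBound_zero : XBound (fun _ : EuclideanSpace ℝ (Fin 3) => (0 : EuclideanSpace ℝ (Fin 3))) 0 := by
  refine ⟨contDiff_const, fun y => ?_⟩
  have h0 : (fun _ : EuclideanSpace ℝ (Fin 3) => (0 : EuclideanSpace ℝ (Fin 3))) = 0 := rfl
  simp [h0]

/-- **X is closed under addition**: radii add. -/
theorem XBound.add {W₁ W₂ : EuclideanSpace ℝ (Fin 3) → EuclideanSpace ℝ (Fin 3)} {R₁ R₂ : ℝ}
    (h₁ : XBound W₁ R₁) (h₂ : XBound W₂ R₂) : XBound (fun y => W₁ y + W₂ y) (R₁ + R₂) := by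
  refine ⟨h₁.1.add h₂.1, fun y => ⟨?_, ?_, ?_⟩⟩
  · calc (1 + ‖y‖) * ‖W₁ y + W₂ y‖ ≤ (1 + ‖y‖) * (‖W₁ y‖ + ‖W₂ y‖) :=
          mul_le_mul_of_nonneg_left (norm_add_le _ _) (by positivity)
      _ ≤ R₁ + R₂ := by rw [mul_add]; exact add_le_add (h₁.2 y).1 (h₂.2 y).1
  · rw [fderiv_fun_add (h₁.1.differentiable (by norm_num) y) (h₂.1.differentiable (by norm_num) y)]
    calc (1 + ‖y‖) * ‖fderiv ℝ W₁ y + fderiv ℝ W₂ y‖ ≤ (1 + ‖y‖) * (‖fderiv ℝ W₁ y‖ + ‖fderiv ℝ W₂ y‖) :=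
          mul_le_mul_of_nonneg_left (norm_add_le _ _) (by positivity)
      _ ≤ R₁ + R₂ := by rw [mul_add]; exact add_le_add (h₁.2 y).2.1 (h₂.2 y).2.1
  · have e : (fun y => W₁ y + W₂ y) = W₁ + W₂ := rfl
    rw [e, iteratedFDeriv_add_apply h₁.1.contDiffAt h₂.1.contDiffAt]
    calc (1 + ‖y‖) * ‖iteratedFDeriv ℝ 2 W₁ y + iteratedFDeriv ℝ 2 W₂ y‖
          ≤ (1 + ‖y‖) * (‖iteratedFDeriv ℝ 2 W₁ y‖ + ‖iteratedFDeriv ℝ 2 W₂ y‖) :=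
          mul_le_mul_of_nonneg_left (norm_add_le _ _) (by positivity)
      _ ≤ R₁ + R₂ := by rw [mul_add]; exact add_le_add (h₁.2 y).2.2 (h₂.2 y).2.2

/-- **X is closed under scalar multiplication**: the radius scales by `|c|`. -/
theorem XBound.smul {W : EuclideanSpace ℝ (Fin 3) → EuclideanSpace ℝ (Fin 3)} {R : ℝ} (h : XBound W R) (c : ℝ) :
    XBound (fun y => c • W y) (|c| * R) := by
  refine ⟨h.1.const_smul c, fun y => ⟨?_, ?_, ?_⟩⟩
  · rw [norm_smul, Real.norm_eq_abs, mul_left_comm]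
    exact mul_le_mul_of_nonneg_left (h.2 y).1 (abs_nonneg c)
  · rw [fderiv_fun_const_smul (h.1.differentiable (by norm_num) y), norm_smul, Real.norm_eq_abs, mul_left_comm]
    exact mul_le_mul_of_nonneg_left (h.2 y).2.1 (abs_nonneg c)
  · have e : (fun y => c • W y) = c • W := rfl
    rw [e, iteratedFDeriv_const_smul_apply (h.1.contDiffAt), norm_smul, Real.norm_eq_abs, mul_left_comm]
    exact mul_le_mul_of_nonneg_left (h.2 y).2.2 (abs_nonneg c)

/-! ## The Y-scale -/

/-- A Y-bound forces `0 ≤ R`. -/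
theorem YBound.nonneg {F : EuclideanSpace ℝ (Fin 3) → EuclideanSpace ℝ (Fin 3)} {R : ℝ} (h : YBound F R) : 0 ≤ R :=
  le_trans (mul_nonneg (by positivity) (norm_nonneg _)) (h.2 0).1

/-- Y-bounds are monotone in the radius. -/
theorem YBound.mono {F : EuclideanSpace ℝ (Fin 3) → EuclideanSpace ℝ (Fin 3)} {R R' : ℝ} (h : YBound F R)
    (hR : R ≤ R') : YBound F R' :=
  ⟨h.1, fun y => ⟨(h.2 y).1.trans hR, (h.2 y).2.trans hR⟩⟩

/-- The pointwise decay encoded by a Y-bound: `‖F y‖ ≤ R / (1 + ‖y‖)²`. -/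
theorem YBound.norm_le {F : EuclideanSpace ℝ (Fin 3) → EuclideanSpace ℝ (Fin 3)} {R : ℝ} (h : YBound F R)
    (y : EuclideanSpace ℝ (Fin 3)) : ‖F y‖ ≤ R / (1 + ‖y‖) ^ 2 := by
  rw [le_div_iff₀ (by positivity), mul_comm]
  exact (h.2 y).1

/-- A Y-bound of radius `≤ 0` forces the zero field. -/
theorem YBound.eq_zero_of_nonpos {F : EuclideanSpace ℝ (Fin 3) → EuclideanSpace ℝ (Fin 3)} {R : ℝ}
    (h : YBound F R) (hR : R ≤ 0) : F = fun _ => 0 := by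
  funext y
  have h1 : (1 + ‖y‖) ^ 2 * ‖F y‖ ≤ 0 := (h.2 y).1.trans hR
  have h2 : ‖F y‖ ≤ 0 := by
    by_contra hlt
    push Not at hlt
    exact absurd h1 (not_le.mpr (mul_pos (by positivity) hlt))
  exact norm_le_zero_iff.mp h2

/-- The zero field is Y-bounded with radius `0`. -/
theorem yBound_zero : YBound (fun _ : EuclideanSpace ℝ (Fin 3) => (0 : EuclideanSpace ℝ (Fin 3))) 0 := by
  refine ⟨contDiff_const, fun y => ?_⟩
  simp

/-- **Y is closed under addition**: radii add. -/
theorem YBound.add {F₁ F₂ : EuclideanSpace ℝ (Fin 3) → EuclideanSpace ℝ (Fin 3)} {R₁ R₂ : ℝ}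
    (h₁ : YBound F₁ R₁) (h₂ : YBound F₂ R₂) : YBound (fun y => F₁ y + F₂ y) (R₁ + R₂) := by
  refine ⟨h₁.1.add h₂.1, fun y => ⟨?_, ?_⟩⟩
  · calc (1 + ‖y‖) ^ 2 * ‖F₁ y + F₂ y‖ ≤ (1 + ‖y‖) ^ 2 * (‖F₁ y‖ + ‖F₂ y‖) :=
          mul_le_mul_of_nonneg_left (norm_add_le _ _) (by positivity)
      _ ≤ R₁ + R₂ := by rw [mul_add]; exact add_le_add (h₁.2 y).1 (h₂.2 y).1
  · rw [fderiv_fun_add (h₁.1.differentiable (by norm_num) y) (h₂.1.differentiable (by norm_num) y)]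
    calc (1 + ‖y‖) ^ 2 * ‖fderiv ℝ F₁ y + fderiv ℝ F₂ y‖
          ≤ (1 + ‖y‖) ^ 2 * (‖fderiv ℝ F₁ y‖ + ‖fderiv ℝ F₂ y‖) :=
          mul_le_mul_of_nonneg_left (norm_add_le _ _) (by positivity)
      _ ≤ R₁ + R₂ := by rw [mul_add]; exact add_le_add (h₁.2 y).2 (h₂.2 y).2

/-- **Y is closed under scalar multiplication**: the radius scales by `|c|`. -/
theorem YBound.smul {F : EuclideanSpace ℝ (Fin 3) → EuclideanSpace ℝ (Fin 3)} {R : ℝ} (h : YBound F R) (c : ℝ) :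
    YBound (fun y => c • F y) (|c| * R) := by
  refine ⟨h.1.const_smul c, fun y => ⟨?_, ?_⟩⟩
  · rw [norm_smul, Real.norm_eq_abs, mul_left_comm]
    exact mul_le_mul_of_nonneg_left (h.2 y).1 (abs_nonneg c)
  · rw [fderiv_fun_const_smul (h.1.differentiable (by norm_num) y), norm_smul, Real.norm_eq_abs, mul_left_comm]
    exact mul_le_mul_of_nonneg_left (h.2 y).2 (abs_nonneg c)

/-! ## `lerayLin` is linear and is the linearisation of `lerayOp` (def form) -/

/-- **Linearity of the line's `lerayLin` in `W`** at every point where the two fields are `C²`: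
`𝓛(W₁ + s W₂)(y) = 𝓛 W₁(y) + s 𝓛 W₂(y)` (def-form of `lerayLin_formula_add_smul`). -/
theorem lerayLin_add_smul (α s : ℝ) (U0 W₁ W₂ : EuclideanSpace ℝ (Fin 3) → EuclideanSpace ℝ (Fin 3))
    (y : EuclideanSpace ℝ (Fin 3)) (h₁ : ContDiffAt ℝ 2 W₁ y) (h₂ : ContDiffAt ℝ 2 W₂ y) :
    lerayLin α U0 (fun z => W₁ z + s • W₂ z) y = lerayLin α U0 W₁ y + s • lerayLin α U0 W₂ y :=
  lerayLin_formula_add_smul α s U0 W₁ W₂ y h₁ h₂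

/-- **`lerayLin` is the linearisation of `lerayOp` with exact quadratic remainder `DW[W]`** at every point where
`U⁰, W` are `C²`: `E_α(U⁰ + W)(y) = E_α(U⁰)(y) + 𝓛_(α,U⁰) W(y) + DW(y)[W(y)]` (def-form of `lerayOp_formula_add`). -/
theorem lerayOp_add_eq (α : ℝ) (U0 W : EuclideanSpace ℝ (Fin 3) → EuclideanSpace ℝ (Fin 3))
    (y : EuclideanSpace ℝ (Fin 3)) (hU : ContDiffAt ℝ 2 U0 y) (hW : ContDiffAt ℝ 2 W y) :
    lerayOp α (fun z => U0 z + W z) y = lerayOp α U0 y + lerayLin α U0 W y + fderiv ℝ W y (W y) :=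
  lerayOp_formula_add α U0 W y hU hW

/-! ## The gate spec is monotone in its constants -/

/-- **Monotonicity of `GateSpec` in `(κ, C₂)`** for `Γ ≥ 1` and `C₂ ≥ 0`: every bound `≤ C₂ Γ^κ R` is also
`≤ C₂' Γ^κ' R` (the data radius `R` is `≥ 0` by `YBound.nonneg`), and the equation, divergence, linearity,
tightness and continuity clauses do not mention the constants. -/
theorem GateSpec.mono {N : ℕ} {Γ κ κ' C₂ C₂' : ℝ} {α : (Fin N → ℝ) → ℝ}
    {D : (Fin N → ℝ) → Fin N → EuclideanSpace ℝ (Fin 3) → EuclideanSpace ℝ (Fin 3)}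
    {U0 : (Fin N → ℝ) → EuclideanSpace ℝ (Fin 3) → EuclideanSpace ℝ (Fin 3)}
    {𝓚 : (Fin N → ℝ) → (EuclideanSpace ℝ (Fin 3) → EuclideanSpace ℝ (Fin 3)) → EuclideanSpace ℝ (Fin 3) → EuclideanSpace ℝ (Fin 3)}
    {𝓠 : (Fin N → ℝ) → (EuclideanSpace ℝ (Fin 3) → EuclideanSpace ℝ (Fin 3)) → EuclideanSpace ℝ (Fin 3) → ℝ}
    {𝓑 : (Fin N → ℝ) → (EuclideanSpace ℝ (Fin 3) → EuclideanSpace ℝ (Fin 3)) → Fin N → ℝ}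
    (h : GateSpec N Γ κ C₂ α D U0 𝓚 𝓠 𝓑) (hΓ : 1 ≤ Γ) (hC₂ : 0 ≤ C₂) (hC : C₂ ≤ C₂') (hκ : κ ≤ κ') :
    GateSpec N Γ κ' C₂' α D U0 𝓚 𝓠 𝓑 := by
  intro p hp
  obtain ⟨h1, h2, h3, h4⟩ := h p hp
  refine ⟨fun F R hF => ?_, h2, h3, h4⟩
  obtain ⟨hX, hQ1, hQ, hB, hdiv, heq⟩ := h1 F R hF
  have hR : 0 ≤ R := hF.nonneg
  have hle : C₂ * Γ ^ κ * R ≤ C₂' * Γ ^ κ' * R := by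
    apply mul_le_mul_of_nonneg_right _ hR
    calc C₂ * Γ ^ κ ≤ C₂ * Γ ^ κ' := mul_le_mul_of_nonneg_left (Real.rpow_le_rpow_of_exponent_le hΓ hκ) hC₂
      _ ≤ C₂' * Γ ^ κ' := mul_le_mul_of_nonneg_right hC (Real.rpow_nonneg (by linarith) _)
  exact ⟨hX.mono hle, hQ1, fun y => (hQ y).trans hle, fun j => (hB j).trans hle, hdiv, heq⟩

/-- A gate maps the zero forcing to the zero field with zero multipliers (the zero field is Y-bounded with radius
`0`, and an X-bound of radius `0` forces `0`). -/
theorem GateSpec.apply_zero {N : ℕ} {Γ κ C₂ : ℝ} {α : (Fin N → ℝ) → ℝ}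
    {D : (Fin N → ℝ) → Fin N → EuclideanSpace ℝ (Fin 3) → EuclideanSpace ℝ (Fin 3)}
    {U0 : (Fin N → ℝ) → EuclideanSpace ℝ (Fin 3) → EuclideanSpace ℝ (Fin 3)}
    {𝓚 : (Fin N → ℝ) → (EuclideanSpace ℝ (Fin 3) → EuclideanSpace ℝ (Fin 3)) → EuclideanSpace ℝ (Fin 3) → EuclideanSpace ℝ (Fin 3)}
    {𝓠 : (Fin N → ℝ) → (EuclideanSpace ℝ (Fin 3) → EuclideanSpace ℝ (Fin 3)) → EuclideanSpace ℝ (Fin 3) → ℝ}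
    {𝓑 : (Fin N → ℝ) → (EuclideanSpace ℝ (Fin 3) → EuclideanSpace ℝ (Fin 3)) → Fin N → ℝ}
    (h : GateSpec N Γ κ C₂ α D U0 𝓚 𝓠 𝓑) {p : Fin N → ℝ} (hp : ∀ i, p i ∈ Icc (0:ℝ) 1) :
    𝓚 p (fun _ => 0) = (fun _ => 0) ∧ ∀ j, 𝓑 p (fun _ => 0) j = 0 := by
  obtain ⟨hX, -, -, hB, -, -⟩ := (h p hp).1 (fun _ => 0) 0 yBound_zero
  refine ⟨hX.eq_zero_of_nonpos (by simp), fun j => ?_⟩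
  have := hB j
  simp only [mul_zero] at this
  exact abs_nonpos_iff.mp this

/-! ## Normal form of the stub: `Cs > 0`, `Cr ≥ 0`, `Γ ≥ 1` -/

/-- **A base family can only exist for `Cs > 0` and `Cr ≥ 0`** (at `Γ > 0`, `N > 0`): at the corner `p = 0` of the
cube the non-degeneracy `1 ≤ ‖U⁰_p y₀‖` contradicts the size bound `(1+‖y₀‖)‖U⁰_p y₀‖ ≤ Cs Γ⁴` unless `Cs > 0`, and
the residual bound `(1+‖y‖)²‖r_p y‖ ≤ Cr Γ^{-k}` forces `Cr ≥ 0`. -/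
theorem BaseSpec.pos {N : ℕ} {Γ ρ η Rw : ℝ} {k : ℕ} {Cs Cr : ℝ} {α : (Fin N → ℝ) → ℝ}
    {X : (Fin N → ℝ) → Fin N → ℝ → EuclideanSpace ℝ (Fin 3)}
    {u : (Fin N → ℝ) → (Fin N → ℝ → EuclideanSpace ℝ (Fin 3)) → EuclideanSpace ℝ (Fin 3) → EuclideanSpace ℝ (Fin 3)}
    {D : (Fin N → ℝ) → Fin N → EuclideanSpace ℝ (Fin 3) → EuclideanSpace ℝ (Fin 3)}
    {U0 : (Fin N → ℝ) → EuclideanSpace ℝ (Fin 3) → EuclideanSpace ℝ (Fin 3)} {P0 : (Fin N → ℝ) → EuclideanSpace ℝ (Fin 3) → ℝ}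
    {b0 : (Fin N → ℝ) → Fin N → ℝ} (hΓ : 0 < Γ) (h : BaseSpec N Γ ρ η Rw k Cs Cr α X u D U0 P0 b0) :
    0 < Cs ∧ 0 ≤ Cr := by
  have hp : ∀ i : Fin N, (fun _ : Fin N => (0:ℝ)) i ∈ Icc (0:ℝ) 1 := fun _ => ⟨le_rfl, zero_le_one⟩
  obtain ⟨-, -, -, hX, -, -, ⟨y₀, hy₀⟩, -, hY, -⟩ := h.2 (fun _ => 0) hp
  refine ⟨?_, ?_⟩
  · by_contra hCs
    push Not at hCs
    have hW := hX.eq_zero_of_nonpos (mul_nonpos_of_nonpos_of_nonneg hCs (by positivity))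
    have : U0 (fun _ => 0) y₀ = 0 := congrFun hW y₀
    rw [this, norm_zero] at hy₀
    exact absurd hy₀ (by norm_num)
  · have h0 := hY.nonneg
    have hpow : 0 < Γ ^ (-(k:ℝ)) := Real.rpow_pos_of_pos hΓ _
    nlinarith

/-- **Normal form of stub S2.**  `PolynomialKelvinGate` is equivalent to its restriction to POSITIVE size constants
`Cs > 0`, NON-NEGATIVE residual constants `Cr ≥ 0` and thresholds `Γ₁ ≥ 1`: outside this region `BaseSpec` is
uninhabited at every `Γ ≥ 1` (`BaseSpec.pos`), so the stub holds vacuously there; and a threshold may always be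
enlarged. -/
theorem polynomialKelvinGate_iff_pos :
    PolynomialKelvinGate ↔
    ∀ (N : ℕ) (δ ρ K Λ a b cnd η Rw Rb cg θ₀ : ℝ), 0 < N → 0 < δ → 0 < ρ → 0 ≤ a → 0 < η → 0 < Rw → 0 < Rb → 0 < cg → 0 < θ₀ →
    ∀ Cs : ℝ, 0 < Cs → ∃ κ C₂ : ℝ, ∀ k : ℕ, 1 ≤ k → ∀ Cr : ℝ, 0 ≤ Cr → ∃ Γ₁ : ℝ, 1 ≤ Γ₁ ∧ ∀ Γ : ℝ, Γ₁ ≤ Γ → ∀ (γ : (Fin N → ℝ) → Fin N → ℝ) (α : (Fin N → ℝ) → ℝ) (X : (Fin N → ℝ) → Fin N → ℝ → EuclideanSpace ℝ (Fin 3)) (w : (Fin N → ℝ) → Fin N → ℝ → ℝ) (c : (Fin N → ℝ) → Fin N → ℝ) (m : (Fin N → ℝ) → Fin N → EuclideanSpace ℝ (Fin 3)) (n : (Fin N → ℝ) → Fin N → EuclideanSpace ℝ (Fin 3)) (u : (Fin N → ℝ) → (Fin N → ℝ → EuclideanSpace ℝ (Fin 3)) → EuclideanSpace ℝ (Fin 3)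 → EuclideanSpace ℝ (Fin 3)) (v : (Fin N → ℝ) → EuclideanSpace ℝ (Fin 3) → EuclideanSpace ℝ (Fin 3)) (A : (Fin N → ℝ) → Fin N → (EuclideanSpace ℝ (Fin 3) →L[ℝ] EuclideanSpace ℝ (Fin 3))) (T : (Fin N → ℝ) → (Fin N → ℝ → EuclideanSpace ℝ (Fin 3)) → Fin N → ℝ → EuclideanSpace ℝ (Fin 3)) (D : (Fin N → ℝ) → Fin N → EuclideanSpace ℝ (Fin 3) → EuclideanSpace ℝ (Fin 3)),
      DefU N Γ γ u → DefV N α X u v → DefA N X c v A → DefT N α u T → DefD N X c D → BoxClausesJ N Γ δ ρ K Λ a b cnd Rw Rb cg θ₀ γ α X w c m n v A T →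
      ∀ (U0 : (Fin N → ℝ) → EuclideanSpace ℝ (Fin 3) → EuclideanSpace ℝ (Fin 3)) (P0 : (Fin N → ℝ) → EuclideanSpace ℝ (Fin 3) → ℝ) (b0 : (Fin N → ℝ) → Fin N → ℝ), BaseSpec N Γ ρ η Rw k Cs Cr α X u D U0 P0 b0 →
      ∃ (𝓚 : (Fin N → ℝ) → (EuclideanSpace ℝ (Fin 3) → EuclideanSpace ℝ (Fin 3)) → EuclideanSpace ℝ (Fin 3) → EuclideanSpace ℝ (Fin 3)) (𝓠 : (Fin N → ℝ) → (EuclideanSpace ℝ (Fin 3) → EuclideanSpace ℝ (Fin 3)) → EuclideanSpace ℝ (Fin 3) → ℝ) (𝓑 : (Fin N → ℝ) → (EuclideanSpace ℝ (Fin 3) → EuclideanSpace ℝ (Fin 3)) → Fin N → ℝ), GateSpec N Γ κ C₂ α D U0 𝓚 𝓠 𝓑 := by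
  constructor
  · intro h N δ ρ K Λ a b cnd η Rw Rb cg θ₀ hN hδ hρ ha hη hRw hRb hcg hθ₀ Cs _
    obtain ⟨κ, C₂, hk⟩ := h N δ ρ K Λ a b cnd η Rw Rb cg θ₀ hN hδ hρ ha hη hRw hRb hcg hθ₀ Cs
    refine ⟨κ, C₂, fun k hk1 Cr _ => ?_⟩
    obtain ⟨Γ₁, hΓ₁⟩ := hk k hk1 Cr
    exact ⟨max Γ₁ 1, le_max_right _ _, fun Γ hΓ => hΓ₁ Γ ((le_max_left _ _).trans hΓ)⟩
  · intro h N δ ρ K Λ a b cnd η Rw Rb cg θ₀ hN hδ hρ ha hη hRw hRb hcg hθ₀ Cs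
    by_cases hCs : 0 < Cs
    · obtain ⟨κ, C₂, hk⟩ := h N δ ρ K Λ a b cnd η Rw Rb cg θ₀ hN hδ hρ ha hη hRw hRb hcg hθ₀ Cs hCs
      refine ⟨κ, C₂, fun k hk1 Cr => ?_⟩
      by_cases hCr : 0 ≤ Cr
      · obtain ⟨Γ₁, -, hΓ₁⟩ := hk k hk1 Cr hCr
        exact ⟨Γ₁, hΓ₁⟩
      · -- `Cr < 0`: no base family exists at `Γ ≥ 1`
        refine ⟨1, fun Γ hΓ γ α X w c m n u v A T D _ _ _ _ _ _ U0 P0 b0 hbase => ?_⟩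
        exact absurd (BaseSpec.pos (by linarith) hbase).2 hCr
    · -- `Cs ≤ 0`: no base family exists at `Γ ≥ 1`
      refine ⟨0, 0, fun k _ Cr => ⟨1, fun Γ hΓ γ α X w c m n u v A T D _ _ _ _ _ _ U0 P0 b0 hbase => ?_⟩⟩
      exact absurd (BaseSpec.pos (by linarith) hbase).1 hCs

end Summit.NavierStokesRegularity.NavierStokesRegularity.Theorems.KelvinGate
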